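import Literature.NumberTheory.EllipticCurves.Skinner2016.HidaCongruentMembers
import Summits.BirchSwinnertonDyer.BirchSwinnertonDyer.Theorems.EisensteinPrimesBSDpOnCellCTelescopeBranchIntegralIntertwiner
import HarnessLib

/-!
# Crux 4 (`BSDpOnCellC`), line telescope, leaf N1 `stub_branchLattice`: brick «B-iso», matrix half IN MEMBER CURRENCY —
# under (rat) `ℤ_p ↠ 𝒪_t`, the member field `K_t = padicCoeffField ι` IS `ℚ_p`, and a `GL_n(K_t)`-conjugacy between a `ℤ_p`-integral and an
# `𝒪_t`-integral matrix representation yields an integral intertwiner with quasi-inverse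

Companion of `…TelescopeBranchIntegralIntertwiner` (p766830; the `X = 0` fibre, clause (G-fib₀) of `Cruxes/BSDpOnCellC/T-GAL-FACTTEXT.md` §3a) for the
member fibres (G-fib_t): there the conjugating matrix lives in `GL₂(K_t)`, `K_t = padicCoeffField (D t).ι`, and the member lattice `(D t).Δ.selfDualRep`
has entries in `𝒪_t = padicCoeffIntegers (D t).ι`; clause (G-rat) (= x2-p2 g23's (rat_k), LEAD v15's «T-An-2ʳ») says `algebraMap ℤ_[p] 𝒪_t` is onto.
Contents: (i) `exists_pow_mul_mem_padicCoeffIntegers` — `K = 𝒪[1/p]` (norms in `ℚ̄_p`); (ii) `bijective_algebraMap_padicCoeffField` — under (rat) the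
structure map `ℚ_p → K` is bijective (field-level companion of `TelescopeK2MemberControlModOfTransport.bijective_algebraMap_padicCoeffIntegers`);
(iii) `exists_map_algebraMap_eq` / `exists_GL_map_eq` — matrices and invertible matrices over `K` come from `ℚ_p`; (iv) `exists_matrix_padicInt_map_eq` —
matrices over `𝒪` come from `ℤ_p`; (v) `exists_descent_and_integral_intertwiner` (ℤ_p-level: `N` descends to `M₂` and `M₁ g Q = Q M₂ g`, the input of x2-p2 g23's module half) and `exists_integral_intertwiner_member` (𝒪-level) — the (fd_k)-shaped statement: from `(M₁ g) = P (N g) P⁻¹` in `GL_n(K)` with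
`M₁` over `ℤ_p`, `N` over `𝒪`, get `Q, Q' ∈ M_n(ℤ_p)`, `c`, with `Q Q' = Q' Q = p^c` and, read in `M_n(𝒪)`, `M₁ g · Q = Q · N g`, `Q' · M₁ g = N g · Q'`.
Helper only (`--supports stmt-BirchSwinnertonDyer-19034 --as helper`); no registered stub, crux or summit statement is proved; BSD is proved for no curve.

References: [EmertonPollackWeston2006] M. Emerton, R. Pollack, T. Weston, Invent. Math. 163 (2006) §3.1 p. 17 (`K`, `𝒪`). [Hida1986] H. Hida, Invent.
Math. 85 (1986) Thm. 2.1 (2.2c), Cor. 1.4 (residue fields of arithmetic points; rationality of members on the `ℤ_p`-chart). [Gouvea1993PadicNumbers]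
F. Gouvêa, *p-adic Numbers*, Cor. 4.2.4 (`ℚ_p = ℤ_p[1/p]`; held copy p. 64).
-/

noncomputable section

set_option linter.dupNamespace false

open scoped MatrixGroups ModularForm
open Literature.NumberTheory.EllipticCurves.ModularForms Literature.NumberTheory.EllipticCurves.GreenbergSelmer

namespace Summit.BirchSwinnertonDyer.BirchSwinnertonDyer.Theorems.TelescopeBranchIntegralIntertwinerMember

variable {Γ : Subgroup (GL (Fin 2) ℝ)} {k : ℤ} {g : CuspForm Γ k} {p : ℕ} [Fact p.Prime]
  (ι : coeffField g →+* PadicAlgCl p)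

/-- `‖p‖ = p⁻¹ < 1` in `ℚ̄_p`, read on the image of `p ∈ K`. [cite: Gouvea1993PadicNumbers, Cor. 4.2.4 (held copy p. 64)] -/
theorem norm_coe_natCast_p : ‖(((p : padicCoeffField ι) : padicCoeffField ι) : PadicAlgCl p)‖ = (p : ℝ)⁻¹ := by
  have h : ((p : padicCoeffField ι) : PadicAlgCl p) = ((algebraMap ℚ_[p] (padicCoeffField ι) (p : ℚ_[p]) : padicCoeffField ι) : PadicAlgCl p) := by
    rw [map_natCast]
  rw [h, norm_coe_algebraMap_padic, Padic.norm_p]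

/-- **`K = 𝒪[1/p]`**: every `x ∈ K = padicCoeffField ι` becomes integral after multiplication by a power of `p`.
[cite: Gouvea1993PadicNumbers, Cor. 4.2.4 (held copy p. 64)] [cite: EmertonPollackWeston2006, §3.1 (p. 17)] -/
theorem exists_pow_mul_mem_padicCoeffIntegers (x : padicCoeffField ι) :
    ∃ a : ℕ, (p : padicCoeffField ι) ^ a * x ∈ padicCoeffIntegers ι := by
  have hp : (1 : ℝ) < p := by exact_mod_cast (Fact.out : p.Prime).one_lt
  obtain ⟨a, ha⟩ := pow_unbounded_of_one_lt ‖(x : PadicAlgCl p)‖ hp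
  refine ⟨a, ?_⟩
  change ‖(((p : padicCoeffField ι) ^ a * x : padicCoeffField ι) : PadicAlgCl p)‖ ≤ 1
  rw [show (((p : padicCoeffField ι) ^ a * x : padicCoeffField ι) : PadicAlgCl p) =
      (((p : padicCoeffField ι) : PadicAlgCl p)) ^ a * (x : PadicAlgCl p) by push_cast; rfl,
    norm_mul, norm_pow, norm_coe_natCast_p, inv_pow]
  have hpa : (0 : ℝ) < (p : ℝ) ^ a := pow_pos (by positivity) a
  rw [inv_mul_le_iff₀ hpa, mul_one]
  exact ha.le

/-- **Under (rat) the structure map `ℚ_p → K` is bijective** (`K = 𝒪[1/p]` and `ℤ_p ↠ 𝒪`). [cite: Hida1986, Cor. 1.4] [cite: EmertonPollackWeston2006, §3.1 (p. 17)] -/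
theorem bijective_algebraMap_padicCoeffField (hrat : Function.Surjective (algebraMap ℤ_[p] (padicCoeffIntegers ι))) :
    Function.Bijective (algebraMap ℚ_[p] (padicCoeffField ι)) := by
  refine ⟨(algebraMap ℚ_[p] (padicCoeffField ι)).injective, fun x => ?_⟩
  obtain ⟨a, ha⟩ := exists_pow_mul_mem_padicCoeffIntegers ι x
  obtain ⟨r, hr⟩ := hrat ⟨_, ha⟩
  have hr' : algebraMap ℚ_[p] (padicCoeffField ι) (r : ℚ_[p]) = (p : padicCoeffField ι) ^ a * x := by
    have := congrArg (fun y : padicCoeffIntegers ι => (y : padicCoeffField ι)) hr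
    simpa only [padicCoeffIntegers.algebraMap_padicInt_eq, padicCoeffIntegers.coe_ofPadicInt] using this
  have hp0 : (p : padicCoeffField ι) ^ a ≠ 0 := pow_ne_zero _ (Nat.cast_ne_zero.mpr (Fact.out : p.Prime).ne_zero)
  refine ⟨(r : ℚ_[p]) / (p : ℚ_[p]) ^ a, ?_⟩
  rw [map_div₀, map_pow, map_natCast, hr', mul_comm, mul_div_assoc, div_self hp0, mul_one]

/-- Under (rat): every matrix over `K` is the image of a matrix over `ℚ_p`. [cite: EmertonPollackWeston2006, §3.1 (p. 17)] -/
theorem exists_map_algebraMap_eq (hrat : Function.Surjective (algebraMap ℤ_[p] (padicCoeffIntegers ι))) {m n : Type*}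
    (A : Matrix m n (padicCoeffField ι)) : ∃ A₀ : Matrix m n ℚ_[p], A₀.map (algebraMap ℚ_[p] (padicCoeffField ι)) = A := by
  choose f hf using (bijective_algebraMap_padicCoeffField ι hrat).2
  exact ⟨A.map f, by ext i j; simp [hf]⟩

/-- Under (rat): every `P ∈ GL_n(K)` is the image of some `P₀ ∈ GL_n(ℚ_p)` (both `P` and `P⁻¹` descend). [cite: EmertonPollackWeston2006, §3.1 (p. 17)] -/
theorem exists_GL_map_eq (hrat : Function.Surjective (algebraMap ℤ_[p] (padicCoeffIntegers ι))) {n : Type*} [Fintype n] [DecidableEq n]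
    (P : GL n (padicCoeffField ι)) :
    ∃ P₀ : GL n ℚ_[p], Matrix.GeneralLinearGroup.map (algebraMap ℚ_[p] (padicCoeffField ι)) P₀ = P := by
  let e : ℚ_[p] ≃+* padicCoeffField ι := RingEquiv.ofBijective _ (bijective_algebraMap_padicCoeffField ι hrat)
  refine ⟨Matrix.GeneralLinearGroup.map e.symm.toRingHom P, Units.ext (funext fun i => funext fun j => ?_)⟩
  change (algebraMap ℚ_[p] (padicCoeffField ι)) (e.symm ((P : Matrix n n (padicCoeffField ι)) i j)) = (P : Matrix n n (padicCoeffField ι)) i j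
  exact e.apply_symm_apply _

/-- Under (rat): every matrix over `𝒪` is the image of a matrix over `ℤ_p`. [cite: EmertonPollackWeston2006, §3.1 (p. 17)] -/
theorem exists_matrix_padicInt_map_eq (hrat : Function.Surjective (algebraMap ℤ_[p] (padicCoeffIntegers ι))) {m n : Type*}
    (A : Matrix m n (padicCoeffIntegers ι)) : ∃ A₀ : Matrix m n ℤ_[p], A₀.map (algebraMap ℤ_[p] (padicCoeffIntegers ι)) = A := by
  choose f hf using hrat
  exact ⟨A.map f, by ext i j; simp [hf]⟩

/-- The square `ℤ_p → ℚ_p → K` = `ℤ_p → 𝒪 → K` on matrices. [cite: EmertonPollackWeston2006, §3.1 (p. 17)] -/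
theorem map_coe_map_algebraMap {m n : Type*} (A : Matrix m n ℤ_[p]) :
    (A.map (algebraMap ℤ_[p] (padicCoeffIntegers ι))).map ((↑) : padicCoeffIntegers ι → padicCoeffField ι) =
      (A.map ((↑) : ℤ_[p] → ℚ_[p])).map (algebraMap ℚ_[p] (padicCoeffField ι)) := by
  ext i j
  simp only [Matrix.map_apply, padicCoeffIntegers.algebraMap_padicInt_eq, padicCoeffIntegers.coe_ofPadicInt]

/-- **Brick «B-iso», matrix half, member currency — `ℤ_p`-level form.** Under (rat): if `M₁ : G → M_n(ℤ_p)` and `N : G → M_n(𝒪)` are conjugate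
in `GL_n(K)` — `(M₁ g) = P (N g) P⁻¹` after the canonical maps — then `N` descends to `M₂ : G → M_n(ℤ_p)` (`(M₂ g).map (ℤ_p → 𝒪) = N g`) and there
are `Q, Q' ∈ M_n(ℤ_p)`, `c : ℕ` with `Q Q' = Q' Q = p^c · 1`, `M₁ g · Q = Q · M₂ g`, `Q' · M₁ g = M₂ g · Q'` — the exact input shape of x2-p2 g23's
module half `TelescopeBranchIsogenyOfIntertwiner.exists_isogeny_of_intertwiner` / `mulVec_intertwines`.
[cite: Hida1986, Thm. 2.1 (2.2c), Cor. 1.4] [cite: EmertonPollackWeston2006, §3.1 (p. 17)] -/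
theorem exists_descent_and_integral_intertwiner (hrat : Function.Surjective (algebraMap ℤ_[p] (padicCoeffIntegers ι))) {G : Type*} {n : ℕ}
    (M₁ : G → Matrix (Fin n) (Fin n) ℤ_[p]) (N : G → Matrix (Fin n) (Fin n) (padicCoeffIntegers ι)) (P : GL (Fin n) (padicCoeffField ι))
    (h : ∀ g, (M₁ g).map (fun z : ℤ_[p] => algebraMap ℚ_[p] (padicCoeffField ι) (z : ℚ_[p])) =
      (P : Matrix (Fin n) (Fin n) (padicCoeffField ι)) * (N g).map ((↑) : padicCoeffIntegers ι → padicCoeffField ι) *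
        ((P⁻¹ : GL (Fin n) (padicCoeffField ι)) : Matrix (Fin n) (Fin n) (padicCoeffField ι))) :
    ∃ (M₂ : G → Matrix (Fin n) (Fin n) ℤ_[p]) (Q Q' : Matrix (Fin n) (Fin n) ℤ_[p]) (c : ℕ),
      (∀ g, (M₂ g).map (algebraMap ℤ_[p] (padicCoeffIntegers ι)) = N g) ∧
      Q * Q' = ((p : ℤ_[p]) ^ c) • (1 : Matrix (Fin n) (Fin n) ℤ_[p]) ∧ Q' * Q = ((p : ℤ_[p]) ^ c) • (1 : Matrix (Fin n) (Fin n) ℤ_[p]) ∧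
      ∀ g, M₁ g * Q = Q * M₂ g ∧ Q' * M₁ g = M₂ g * Q' := by
  classical
  -- pull `N` back to `ℤ_p` and `P` back to `ℚ_p`
  choose M₂ hM₂ using fun g => exists_matrix_padicInt_map_eq ι hrat (N g)
  obtain ⟨P₀, hP₀⟩ := exists_GL_map_eq ι hrat P
  set φ : ℚ_[p] →+* padicCoeffField ι := algebraMap ℚ_[p] (padicCoeffField ι) with hφ
  have hφinj : Function.Injective (fun A : Matrix (Fin n) (Fin n) ℚ_[p] => A.map φ) := fun A B hAB =>
    Matrix.ext fun i j => φ.injective (by simpa using congrArg (fun X : Matrix (Fin n) (Fin n) (padicCoeffField ι) => X i j) hAB)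
  have hPmat : (P : Matrix (Fin n) (Fin n) (padicCoeffField ι)) = (P₀ : Matrix (Fin n) (Fin n) ℚ_[p]).map φ := by
    rw [← hP₀]; rfl
  have hPinv : ((P⁻¹ : GL (Fin n) (padicCoeffField ι)) : Matrix (Fin n) (Fin n) (padicCoeffField ι)) =
      ((P₀⁻¹ : GL (Fin n) ℚ_[p]) : Matrix (Fin n) (Fin n) ℚ_[p]).map φ := by
    rw [← hP₀, ← map_inv]; rfl
  -- conjugacy over `ℚ_p`
  have h0 : ∀ g, (M₁ g).map ((↑) : ℤ_[p] → ℚ_[p]) =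
      (P₀ : Matrix (Fin n) (Fin n) ℚ_[p]) * (M₂ g).map ((↑) : ℤ_[p] → ℚ_[p]) * ((P₀⁻¹ : GL (Fin n) ℚ_[p]) : Matrix (Fin n) (Fin n) ℚ_[p]) := by
    intro g
    apply hφinj
    change ((M₁ g).map ((↑) : ℤ_[p] → ℚ_[p])).map φ = ((P₀ : Matrix (Fin n) (Fin n) ℚ_[p]) * (M₂ g).map ((↑) : ℤ_[p] → ℚ_[p]) *
      ((P₀⁻¹ : GL (Fin n) ℚ_[p]) : Matrix (Fin n) (Fin n) ℚ_[p])).map φ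
    rw [Matrix.map_mul, Matrix.map_mul, ← hPmat, ← hPinv, ← map_coe_map_algebraMap ι (M₂ g), hM₂ g, Matrix.map_map]
    exact h g
  obtain ⟨Q, Q', c, hQQ', hQ'Q, hg⟩ := TelescopeBranchIntegralIntertwiner.exists_integral_intertwiner M₁ M₂ P₀ h0
  exact ⟨M₂, Q, Q', c, hM₂, hQQ', hQ'Q, hg⟩

/-- **Brick «B-iso», matrix half, member currency ((fd_k) shape), `𝒪`-level form.** Under (rat): if `M₁ : G → M_n(ℤ_p)` and `N : G → M_n(𝒪)` are
conjugate in `GL_n(K)`, then there are `Q, Q' ∈ M_n(ℤ_p)` and `c : ℕ` with `Q Q' = Q' Q = p^c · 1` and, read in `M_n(𝒪)`, `M₁ g · Q = Q · N g` and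
`Q' · M₁ g = N g · Q'` for every `g`. [cite: Hida1986, Thm. 2.1 (2.2c), Cor. 1.4] [cite: EmertonPollackWeston2006, §3.1 (p. 17)] -/
theorem exists_integral_intertwiner_member (hrat : Function.Surjective (algebraMap ℤ_[p] (padicCoeffIntegers ι))) {G : Type*} {n : ℕ}
    (M₁ : G → Matrix (Fin n) (Fin n) ℤ_[p]) (N : G → Matrix (Fin n) (Fin n) (padicCoeffIntegers ι)) (P : GL (Fin n) (padicCoeffField ι))
    (h : ∀ g, (M₁ g).map (fun z : ℤ_[p] => algebraMap ℚ_[p] (padicCoeffField ι) (z : ℚ_[p])) =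
      (P : Matrix (Fin n) (Fin n) (padicCoeffField ι)) * (N g).map ((↑) : padicCoeffIntegers ι → padicCoeffField ι) *
        ((P⁻¹ : GL (Fin n) (padicCoeffField ι)) : Matrix (Fin n) (Fin n) (padicCoeffField ι))) :
    ∃ (Q Q' : Matrix (Fin n) (Fin n) ℤ_[p]) (c : ℕ),
      Q * Q' = ((p : ℤ_[p]) ^ c) • (1 : Matrix (Fin n) (Fin n) ℤ_[p]) ∧ Q' * Q = ((p : ℤ_[p]) ^ c) • (1 : Matrix (Fin n) (Fin n) ℤ_[p]) ∧
      ∀ g, (M₁ g).map (algebraMap ℤ_[p] (padicCoeffIntegers ι)) * Q.map (algebraMap ℤ_[p] (padicCoeffIntegers ι)) =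
          Q.map (algebraMap ℤ_[p] (padicCoeffIntegers ι)) * N g ∧
        Q'.map (algebraMap ℤ_[p] (padicCoeffIntegers ι)) * (M₁ g).map (algebraMap ℤ_[p] (padicCoeffIntegers ι)) =
          N g * Q'.map (algebraMap ℤ_[p] (padicCoeffIntegers ι)) := by
  obtain ⟨M₂, Q, Q', c, hM₂, hQQ', hQ'Q, hg⟩ := exists_descent_and_integral_intertwiner ι hrat M₁ N P h
  refine ⟨Q, Q', c, hQQ', hQ'Q, fun g => ⟨?_, ?_⟩⟩
  · rw [← hM₂ g, ← Matrix.map_mul, ← Matrix.map_mul, (hg g).1]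
  · rw [← hM₂ g, ← Matrix.map_mul, ← Matrix.map_mul, (hg g).2]

end Summit.BirchSwinnertonDyer.BirchSwinnertonDyer.Theorems.TelescopeBranchIntegralIntertwinerMember

end
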